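import Literature.Analysis.PDE.LatticePatches
import HarnessLib

/-!
# A translation-invariant lattice partition of unity (topic `Analysis/PDE`)

Refinement of `LatticePatches.lean` for the fine level of the parametrix in the programme to
prove short-time existence for quasilinear strictly parabolic systems on a closed manifold
(hypothesis `hQL` of `Literature.Geometry.Riemannian.ricciFlow_shortTime_existence_of_quasilinear`).
The partition functions of `exists_flatPatches` come from an abstract construction, so their
derivative bounds depend on the (arbitrarily large) region; here the partition is built from ONE
profile translated along the lattice,

  `ρ_k(x) = φ(x - Λk) / D(x)`,  `D(x) = Σᶠ_k φ(x - Λk)`  (a locally finite sum, `Λ`-periodic),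

so that `ρ_k(x) = ρ₀(x - Λk)` exactly (`latticeRho_eq_translate`): all derivative bounds of all
partition functions are those of the single function `ρ₀`, uniformly in the index and in the
region. `exists_flatPatches_translate` packages this as a `FlatPatches` with lattice centres,
radius `√n δ`, mesh `δ`, region `closedBall 0 R`, whose partition functions are translates of one
smooth compactly supported profile.

Everything is proved; no named fact and no `sorry` is introduced.

## References

* L. Hörmander, *The Analysis of Linear Partial Differential Operators I*, Springer 1983,
  Thm. 1.4.6. [folklore]
-/

noncomputable section

open Set Function Metric Filter Topology
open scoped ContDiff Topology RealInnerProductSpace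

namespace Literature.Analysis.PDE

variable {E' : Type*} [NormedAddCommGroup E'] [InnerProductSpace ℝ E'] [FiniteDimensional ℝ E']

/-! ### Linearity of the lattice map -/

/-- The lattice map is additive. [folklore] -/
theorem latticePoint_add (δ : ℝ) (k k' : Fin (Module.finrank ℝ E') → ℤ) :
    (latticePoint δ (k + k') : E') = latticePoint δ k + latticePoint δ k' := by
  simp only [latticePoint, Pi.add_apply, Int.cast_add, add_mul, add_smul, Finset.sum_add_distrib]

/-- The lattice map at `0`. [folklore] -/
theorem latticePoint_zero (δ : ℝ) : (latticePoint δ (0 : Fin (Module.finrank ℝ E') → ℤ) : E') = 0 := by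
  simp [latticePoint]

/-- The lattice map is compatible with subtraction. [folklore] -/
theorem latticePoint_sub (δ : ℝ) (k k' : Fin (Module.finrank ℝ E') → ℤ) :
    (latticePoint δ (k - k') : E') = latticePoint δ k - latticePoint δ k' := by
  rw [eq_sub_iff_add_eq, ← latticePoint_add, sub_add_cancel]

/-! ### The profile, the lattice bumps and the periodic denominator -/

/-- **The profile**: a bump equal to `1` on `closedBall 0 r`, supported in `closedBall 0 (3r/2)`.
[folklore] -/
def bumpProfile {E' : Type*} [NormedAddCommGroup E'] [NormedSpace ℝ E'] {r : ℝ} (hr : 0 < r) :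
    ContDiffBump (0 : E') := ⟨r, 3 / 2 * r, hr, by linarith⟩

omit [InnerProductSpace ℝ E'] [FiniteDimensional ℝ E'] in
/-- `bumpProfile_rIn`: bumpProfile rIn. [folklore] -/
@[simp] theorem bumpProfile_rIn [NormedSpace ℝ E'] {r : ℝ} (hr : 0 < r) : (bumpProfile (E' := E') hr).rIn = r := rfl
omit [InnerProductSpace ℝ E'] [FiniteDimensional ℝ E'] in
/-- `bumpProfile_rOut`: bumpProfile rOut. [folklore] -/
@[simp] theorem bumpProfile_rOut [NormedSpace ℝ E'] {r : ℝ} (hr : 0 < r) :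
    (bumpProfile (E' := E') hr).rOut = 3 / 2 * r := rfl

/-- **The lattice bumps**: the profile translated to the lattice points. [folklore] -/
def latticeBump (δ : ℝ) {r : ℝ} (hr : 0 < r) (k : Fin (Module.finrank ℝ E') → ℤ) (x : E') : ℝ :=
  (bumpProfile (E' := E') hr : E' → ℝ) (x - latticePoint δ k)

/-- **The denominator**: the locally finite sum of all lattice bumps. [folklore] -/
def latticeDenom (δ : ℝ) {r : ℝ} (hr : 0 < r) (x : E') : ℝ := ∑ᶠ k, latticeBump δ hr k x

variable {δ r : ℝ}

/-- A lattice bump is non-zero only at points within `3r/2` of its lattice point. [folklore] -/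
theorem dist_le_of_latticeBump_ne_zero (hr : 0 < r) {k : Fin (Module.finrank ℝ E') → ℤ} {x : E'}
    (h : latticeBump δ hr k x ≠ 0) : dist x (latticePoint δ k) ≤ 3 / 2 * r := by
  by_contra hx
  refine h ?_
  unfold latticeBump
  refine (bumpProfile (E' := E') hr).zero_of_le_dist ?_
  rw [bumpProfile_rOut, dist_zero_right, ← dist_eq_norm]
  exact (not_le.1 hx).le

/-- The indices of the lattice bumps that can be non-zero near a point lie in a fixed finite set.
[folklore] -/
theorem support_latticeBump_subset (hδ : 0 < δ) (hr : 0 < r) {x₀ x : E'} (hx : dist x x₀ ≤ r) :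
    (support fun k ↦ latticeBump δ hr k x) ⊆
      (latticeIndex δ (‖x₀‖ + 3 * r) : Finset (Fin (Module.finrank ℝ E') → ℤ)) := by
  intro k hk
  rw [Finset.mem_coe, mem_latticeIndex hδ]
  have hd := dist_le_of_latticeBump_ne_zero hr hk
  calc ‖(latticePoint δ k : E')‖ = dist (latticePoint δ k) 0 := (dist_zero_right _).symm
    _ ≤ dist (latticePoint δ k) x + dist x x₀ + dist x₀ 0 := dist_triangle4 _ _ _ _
    _ ≤ 3 / 2 * r + r + ‖x₀‖ := by
        rw [dist_comm, dist_zero_right]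
        exact add_le_add (add_le_add hd hx) le_rfl
    _ ≤ ‖x₀‖ + 3 * r := by linarith

/-- The support of the lattice bumps at a point is finite. [folklore] -/
theorem finite_support_latticeBump (hδ : 0 < δ) (hr : 0 < r) (x : E') :
    (support fun k ↦ latticeBump δ hr k x).Finite :=
  (Finset.finite_toSet _).subset (support_latticeBump_subset hδ hr (x₀ := x) (by simp [hr.le]))

/-- Near every point the denominator is a fixed finite sum. [folklore] -/
theorem latticeDenom_eq_sum (hδ : 0 < δ) (hr : 0 < r) {x₀ x : E'} (hx : dist x x₀ ≤ r) :
    latticeDenom δ hr x = ∑ k ∈ latticeIndex δ (‖x₀‖ + 3 * r), latticeBump δ hr k x :=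
  finsum_eq_finsetSum_of_support_subset _ (support_latticeBump_subset hδ hr hx)

/-- The lattice bumps are smooth. [folklore] -/
theorem contDiff_latticeBump (δ : ℝ) (hr : 0 < r) (k : Fin (Module.finrank ℝ E') → ℤ) :
    ContDiff ℝ ∞ (latticeBump δ hr k : E' → ℝ) :=
  (bumpProfile (E' := E') hr).contDiff.comp (contDiff_id.sub contDiff_const)

/-- **The denominator is smooth** (locally a finite sum of smooth functions). [folklore] -/
theorem contDiff_latticeDenom (hδ : 0 < δ) (hr : 0 < r) : ContDiff ℝ ∞ (latticeDenom δ hr : E' → ℝ) := by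
  refine contDiff_iff_contDiffAt.2 fun x₀ ↦ ?_
  have hev : (latticeDenom δ hr : E' → ℝ) =ᶠ[𝓝 x₀]
      fun x ↦ ∑ k ∈ latticeIndex δ (‖x₀‖ + 3 * r), latticeBump δ hr k x := by
    filter_upwards [Metric.closedBall_mem_nhds x₀ hr] with x hx
    exact latticeDenom_eq_sum hδ hr (mem_closedBall.1 hx)
  refine ContDiffAt.congr_of_eventuallyEq ?_ hev
  exact (ContDiff.sum fun k _ ↦ contDiff_latticeBump δ hr k).contDiffAt

/-- **The denominator is lattice-periodic.** [folklore] -/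
theorem latticeDenom_add_latticePoint (δ : ℝ) (hr : 0 < r) (x : E') (k₀ : Fin (Module.finrank ℝ E') → ℤ) :
    latticeDenom δ hr (x + latticePoint δ k₀) = latticeDenom δ hr x := by
  unfold latticeDenom
  have h : ∀ k, latticeBump δ hr k (x + latticePoint δ k₀) = latticeBump δ hr (k - k₀) x := by
    intro k
    unfold latticeBump
    rw [latticePoint_sub]
    congr 1
    abel
  simp_rw [h]
  exact finsum_comp_equiv (Equiv.subRight k₀) (f := fun k ↦ latticeBump δ hr k x)

/-- The denominator dominates each bump. [folklore] -/
theorem latticeBump_le_latticeDenom (hδ : 0 < δ) (hr : 0 < r) (k : Fin (Module.finrank ℝ E') → ℤ) (x : E') :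
    latticeBump δ hr k x ≤ latticeDenom δ hr x :=
  single_le_finsum k (finite_support_latticeBump hδ hr x) fun _ ↦ (bumpProfile (E' := E') hr).nonneg

/-- **The denominator is at least `1`** when the radius is the covering radius `√n δ`.
[folklore] -/
theorem one_le_latticeDenom (hδ : 0 < δ) (hr : 0 < r) (hrn : Real.sqrt (Module.finrank ℝ E') * δ ≤ r) (x : E') :
    1 ≤ latticeDenom δ hr x := by
  obtain ⟨k, hk⟩ := exists_latticePoint_dist_le hδ x
  have h1 : latticeBump δ hr k x = 1 := by
    unfold latticeBump
    refine (bumpProfile (E' := E') hr).one_of_mem_closedBall ?_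
    rw [bumpProfile_rIn, mem_closedBall, dist_zero_right, ← dist_eq_norm]
    exact hk.trans hrn
  rw [← h1]
  exact latticeBump_le_latticeDenom hδ hr k x

/-! ### The partition functions -/

/-- **The lattice partition functions** `ρ_k = φ_k / D`. [folklore] -/
def latticeRho (δ : ℝ) {r : ℝ} (hr : 0 < r) (k : Fin (Module.finrank ℝ E') → ℤ) (x : E') : ℝ :=
  latticeBump δ hr k x / latticeDenom δ hr x

/-- The partition functions are smooth. [folklore] -/
theorem contDiff_latticeRho (hδ : 0 < δ) (hr : 0 < r) (hrn : Real.sqrt (Module.finrank ℝ E') * δ ≤ r)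
    (k : Fin (Module.finrank ℝ E') → ℤ) : ContDiff ℝ ∞ (latticeRho δ hr k : E' → ℝ) :=
  (contDiff_latticeBump δ hr k).div (contDiff_latticeDenom hδ hr) fun x ↦
    (zero_lt_one.trans_le (one_le_latticeDenom hδ hr hrn x)).ne'

/-- The partition functions are non-negative. [folklore] -/
theorem latticeRho_nonneg (hδ : 0 < δ) (hr : 0 < r) (hrn : Real.sqrt (Module.finrank ℝ E') * δ ≤ r)
    (k : Fin (Module.finrank ℝ E') → ℤ) (x : E') : 0 ≤ latticeRho δ hr k x :=
  div_nonneg (bumpProfile (E' := E') hr).nonneg (zero_le_one.trans (one_le_latticeDenom hδ hr hrn x))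

/-- The partition functions are at most `1`. [folklore] -/
theorem latticeRho_le_one (hδ : 0 < δ) (hr : 0 < r) (hrn : Real.sqrt (Module.finrank ℝ E') * δ ≤ r)
    (k : Fin (Module.finrank ℝ E') → ℤ) (x : E') : latticeRho δ hr k x ≤ 1 :=
  div_le_one_of_le₀ (latticeBump_le_latticeDenom hδ hr k x) (zero_le_one.trans (one_le_latticeDenom hδ hr hrn x))

/-- The supports of the partition functions. [folklore] -/
theorem tsupport_latticeRho_subset (hr : 0 < r) (k : Fin (Module.finrank ℝ E') → ℤ) :
    tsupport (latticeRho δ hr k : E' → ℝ) ⊆ ball (latticePoint δ k) (2 * r) := by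
  intro x hx
  -- `support ρ_k ⊆ support φ_k ⊆ closedBall (Λk) (3r/2)`
  have h1 : support (latticeRho δ hr k : E' → ℝ) ⊆ closedBall (latticePoint δ k) (3 / 2 * r) := by
    intro y hy
    rw [mem_support] at hy
    have hy' : latticeBump δ hr k y ≠ 0 := fun h ↦ hy (by simp [latticeRho, h])
    exact mem_closedBall.2 (dist_le_of_latticeBump_ne_zero hr hy')
  have h2 : tsupport (latticeRho δ hr k : E' → ℝ) ⊆ closedBall (latticePoint δ k) (3 / 2 * r) :=
    closure_minimal h1 isClosed_closedBall
  have h := h2 hx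
  rw [mem_closedBall] at h
  rw [mem_ball]
  linarith

/-- **Translation invariance**: `ρ_k(x) = ρ_0(x - Λk)`. [folklore] -/
theorem latticeRho_eq_translate (δ : ℝ) (hr : 0 < r) (k : Fin (Module.finrank ℝ E') → ℤ) (x : E') :
    latticeRho δ hr k x = latticeRho δ hr 0 (x - latticePoint δ k) := by
  unfold latticeRho latticeBump
  rw [latticePoint_zero, sub_zero, ← latticeDenom_add_latticePoint δ hr (x - latticePoint δ k) k, sub_add_cancel]

/-- **The partition sums to one** on `closedBall 0 R` over the indices in `latticeIndex δ (R + 3r)`.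
[folklore] -/
theorem sum_latticeRho_eq_one (hδ : 0 < δ) (hr : 0 < r) (hrn : Real.sqrt (Module.finrank ℝ E') * δ ≤ r)
    {R : ℝ} {x : E'} (hx : x ∈ closedBall (0 : E') R) :
    ∑ k ∈ latticeIndex δ (R + 3 * r), latticeRho δ hr k x = 1 := by
  have hD := one_le_latticeDenom hδ hr hrn x
  simp only [latticeRho, div_eq_mul_inv, ← Finset.sum_mul]
  have hsub : (support fun k ↦ latticeBump δ hr k x) ⊆
      (latticeIndex δ (R + 3 * r) : Finset (Fin (Module.finrank ℝ E') → ℤ)) := by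
    refine (support_latticeBump_subset hδ hr (x₀ := x) (by simp [hr.le])).trans fun k hk ↦ ?_
    rw [Finset.mem_coe, mem_latticeIndex hδ] at hk ⊢
    have hxn : ‖x‖ ≤ R := by simpa using hx
    linarith
  rw [← finsum_eq_finsetSum_of_support_subset _ hsub]
  exact mul_inv_cancel₀ (zero_lt_one.trans_le hD).ne'

/-! ### The translation-invariant flat patch family -/

/-- The covering radius `√n δ` is positive in positive dimension. [folklore] -/
theorem coveringRadius_pos [Nontrivial E'] {δ : ℝ} (hδ : 0 < δ) : 0 < Real.sqrt (Module.finrank ℝ E') * δ :=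
  mul_pos (Real.sqrt_pos.2 (by exact_mod_cast Module.finrank_pos)) hδ

/-- **The lattice profile** of mesh `δ`: the partition function of the lattice point `0` for the
covering radius `√n δ`; every partition function is its translate. [folklore] -/
def latticeProfile [Nontrivial E'] {δ : ℝ} (hδ : 0 < δ) : E' → ℝ :=
  latticeRho δ (coveringRadius_pos (E' := E') hδ) 0

/-- The lattice profile is smooth. [folklore] -/
theorem contDiff_latticeProfile [Nontrivial E'] {δ : ℝ} (hδ : 0 < δ) : ContDiff ℝ ∞ (latticeProfile (E' := E') hδ) :=
  contDiff_latticeRho hδ _ le_rfl 0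

/-- The lattice profile is supported in `ball 0 (2√n δ)`. [folklore] -/
theorem tsupport_latticeProfile_subset [Nontrivial E'] {δ : ℝ} (hδ : 0 < δ) :
    tsupport (latticeProfile (E' := E') hδ) ⊆ ball (0 : E') (2 * (Real.sqrt (Module.finrank ℝ E') * δ)) := by
  simpa [latticeProfile, latticePoint_zero] using
    tsupport_latticeRho_subset (δ := δ) (coveringRadius_pos (E' := E') hδ) (0 : Fin (Module.finrank ℝ E') → ℤ)

/-- **Lattice patch families with translation-invariant partition of unity**: for every mesh
`δ > 0` and radius `R` there is a flat patch family with lattice centres, radius `√n δ`, mesh `δ`,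
partition summing to `1` on `closedBall 0 R`, whose partition functions are the translates of the
lattice profile `latticeProfile hδ` (which depends on `δ` only). [folklore] -/
theorem exists_flatPatches_translate [Nontrivial E'] {δ : ℝ} (hδ : 0 < δ) (R : ℝ) :
    ∃ (ι : Type) (_ : Fintype ι) (Q : FlatPatches E' ι),
      Q.r = Real.sqrt (Module.finrank ℝ E') * δ ∧ Q.mesh = δ ∧ closedBall (0 : E') R ⊆ Q.region ∧
      (∀ i, ∃ k, Q.c i = latticePoint δ k) ∧
      ∀ i x, Q.ρ i x = latticeProfile hδ (x - Q.c i) := by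
  classical
  set n := Module.finrank ℝ E'
  have hn : 0 < (n : ℝ) := by exact_mod_cast Module.finrank_pos
  set r : ℝ := Real.sqrt n * δ with hr
  have hr0 : 0 < r := mul_pos (Real.sqrt_pos.2 hn) hδ
  set L := (latticeIndex δ (R + 3 * r) : Finset (Fin n → ℤ))
  refine ⟨↥L, inferInstance,
    { c := fun i ↦ latticePoint δ (i : Fin n → ℤ)
      r := r
      r_pos := hr0
      ρ := fun i ↦ latticeRho δ hr0 (i : Fin n → ℤ)
      ρ_smooth := fun i ↦ contDiff_latticeRho hδ hr0 le_rfl _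
      ρ_nonneg := fun i x ↦ latticeRho_nonneg hδ hr0 le_rfl _ x
      ρ_le_one := fun i x ↦ latticeRho_le_one hδ hr0 le_rfl _ x
      tsupport_ρ := fun i ↦ tsupport_latticeRho_subset hr0 _
      region := closedBall 0 R
      sum_ρ := fun x hx ↦ ?_
      mesh := δ
      mesh_pos := hδ
      card_le := fun x R' hR' T hT ↦ ?_ }, rfl, rfl, Subset.rfl, fun i ↦ ⟨i, rfl⟩,
    fun i x ↦ latticeRho_eq_translate δ hr0 _ x⟩
  · -- the sum over the subtype is the sum over the finset
    have h := sum_latticeRho_eq_one hδ hr0 le_rfl (R := R) hx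
    rw [← h, ← Finset.sum_coe_sort L]
  · set T' : Finset (Fin n → ℤ) := T.image fun i : ↥L ↦ (i : Fin n → ℤ)
    have hTc : T.card = T'.card := (Finset.card_image_of_injective _ Subtype.val_injective).symm
    have hT' : ∀ k ∈ T', dist x (latticePoint δ k) ≤ R' := by
      intro k hk
      obtain ⟨i, hi, rfl⟩ := Finset.mem_image.1 hk
      exact hT i hi
    rw [hTc]
    exact card_le_of_dist_latticePoint_le hδ hR' x hT'

end Literature.Analysis.PDE

end
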